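import Summits.QuantumFields.YangMills.Theorems.LuscherReductionDressedRitzPolyakovLiftPScalingLevels
import Summits.QuantumFields.YangMills.Theorems.LuscherReductionDressedRitzPolyakovLiftPScalingClusters
import HarnessLib

/-!
# ONE AT COUPLING `B` ON THE SPECTRAL WINDOWS `[winLo j, winHi j)` (F9 layer D1b′ for S-PSCAL″ of crux `DressedRitz`, stmt-QuantumFields-20205,
# line «polyakovlift»; seat ym-20205-polyakovlift-w1a g1; helper `--supports`)

`PScal.levels_package` (tree `…PScalingLevels`) instantiated on the LEAD's cluster windows (`PScal.winLo/winHi`, tree `…PScalingClusters`) below a cluster end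
`K` (`E_K < E_{K+1}`), in exactly the shape the dressed-sum engines consume (`SpecSum.ratio_two_sided`: `hσ`, `hlow`, `hΓ`, `hκ`; `ClusterConc.cluster_concentration_in`:
`hgap`, `hκj`, `hsj`).  With `ν = linkC B³`, `x = bareLambda B`, `λ_m = levelValue su2Rep 1 B m`, `E_j = idxLevel j`, and the window floor `λlow_j := ν e^{−E_j x − C x²}`:

* ★★ `levels_window`: for `B ≥ B₁` and every `j ≤ K`: (w0) `0 < λlow_j`; (w1) every window member `m ∈ [winLo j, winHi j)` obeys `λlow_j ≤ λ_m ≤ ν e^{−E_j x + Cx²}` and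
  `|λ_m − λ_j| ≤ 3C·ν·x²`; (w2) `λ_0^{2n} ≤ exp(2n((E_j − E_0)x + 2Cx²))·λlow_j^{2n}`; (w3) `0 < λ_{winLo j} − λ_{winHi j}`,
  `λ_0 − λ_{winLo j} ≤ (C_top/c_gap)(λ_{winLo j} − λ_{winHi j})`, and the F6a θ-form `λ_{winLo j} − ν(1 − x(E_j + t) − x²K′/4) ≤ ((C_s(K′)x + t)/c_gap)(λ_{winLo j} − λ_{winHi j})`.

HONEST FRAMING: elementary repackaging of the closed crux ONE on a fixed one-site lattice (conditional femto rung R2b1); nothing here bears on infinite volume,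
the continuum limit or the Clay gap.
References: M. Lüscher, NPB 219 (1983) 233 [cite: Luscher1983, §2]; Reed–Simon IV, Thm. XIII.1 [cite: ReedSimonIV1978, Thm. XIII.1].
-/

set_option autoImplicit false

noncomputable section

open MeasureTheory Filter Topology Real
open Literature.MathematicalPhysics.QuantumFieldTheory
open Literature.MathematicalPhysics.QuantumLattice
open Literature.Analysis.OperatorTheory.YMMatrixModel

namespace Summit.QuantumFields.YangMills.Theorems.FemtoTransferGap.PScal

open Summit.QuantumFields.YangMills.Theorems.FemtoTransferGap

/-- ★★ **ONE at coupling `B` on the spectral windows below a cluster end `K`.** [cite: Luscher1983, §2] [cite: ReedSimonIV1978, Thm. XIII.1] -/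
theorem levels_window (K : ℕ) (hK : idxLevel K < idxLevel (K + 1)) :
    ∃ C cgap Ctop x₀ B₁ : ℝ, 0 ≤ C ∧ 0 < cgap ∧ 0 ≤ Ctop ∧ 0 < x₀ ∧ 0 < B₁ ∧ ∀ B : ℝ, B₁ ≤ B →
      0 < bareLambda B ∧ bareLambda B ≤ x₀ ∧ 0 < linkC B ^ 3 ∧
      idxLevel (K + 1) * bareLambda B + C * bareLambda B ^ 2 ≤ 1 / 2 ∧
      (linkC B ^ 3 / 2 ≤ levelValue su2Rep 1 B 0 ∧ levelValue su2Rep 1 B 0 ≤ 2 * linkC B ^ 3) ∧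
      ∀ j : ℕ, j ≤ K →
        -- (w0) the window floor is positive, and bounds `λ_j` itself
        0 < linkC B ^ 3 * Real.exp (-(idxLevel j * bareLambda B) - C * bareLambda B ^ 2) ∧
        0 < levelValue su2Rep 1 B j ∧
        -- (w1) window members
        (∀ m : ℕ, winLo j ≤ m → m < winHi j →
          linkC B ^ 3 * Real.exp (-(idxLevel j * bareLambda B) - C * bareLambda B ^ 2) ≤ levelValue su2Rep 1 B m ∧
          levelValue su2Rep 1 B m ≤ linkC B ^ 3 * Real.exp (-(idxLevel j * bareLambda B) + C * bareLambda B ^ 2) ∧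
          |levelValue su2Rep 1 B m - levelValue su2Rep 1 B j| ≤ 3 * C * linkC B ^ 3 * bareLambda B ^ 2) ∧
        -- (w2) dressed ratio against the window floor
        (∀ n : ℕ, levelValue su2Rep 1 B 0 ^ (2 * n) ≤
          Real.exp (2 * n * ((idxLevel j - idxLevel 0) * bareLambda B + 2 * C * bareLambda B ^ 2)) *
            (linkC B ^ 3 * Real.exp (-(idxLevel j * bareLambda B) - C * bareLambda B ^ 2)) ^ (2 * n)) ∧
        -- (w3) the window gap, the top budget and the F6a θ-form
        0 < levelValue su2Rep 1 B (winLo j) - levelValue su2Rep 1 B (winHi j) ∧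
        cgap * linkC B ^ 3 * bareLambda B ≤ levelValue su2Rep 1 B (winLo j) - levelValue su2Rep 1 B (winHi j) ∧
        levelValue su2Rep 1 B 0 - levelValue su2Rep 1 B (winLo j) ≤
          Ctop / cgap * (levelValue su2Rep 1 B (winLo j) - levelValue su2Rep 1 B (winHi j)) ∧
        (∀ t K' : ℝ, 0 ≤ t → 0 ≤ K' →
          levelValue su2Rep 1 B (winLo j) - linkC B ^ 3 * (1 - bareLambda B * (idxLevel j + t) - bareLambda B ^ 2 * K' / 4) ≤
            ((C + (idxLevel (K + 1) + C) ^ 2 + K' / 4) * bareLambda B + t) / cgap *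
              (levelValue su2Rep 1 B (winLo j) - levelValue su2Rep 1 B (winHi j))) := by
  obtain ⟨C, cgap, Ctop, x₀, B₁, hC, hcg, hCt, hx₀, hB₁, hpk⟩ := levels_package (K + 1)
  refine ⟨C, cgap, Ctop, x₀, B₁, hC, hcg, hCt, hx₀, hB₁, fun B hB => ?_⟩
  obtain ⟨hx, hxx₀, hν, hreg, hab, h0, hGAP, hSPREAD, hTOP, hRATIO, hWIN⟩ := hpk B hB
  simp only [idxLevel_eq]
  refine ⟨hx, hxx₀, hν, hreg, h0, fun j hj => ?_⟩
  have hjM : j ≤ K + 1 := by omega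
  have hhi : winHi j ≤ K + 1 := winHi_le_of_clusterEnd hK hj
  have hlo : winLo j ≤ K + 1 := (winLo_le j).trans hjM
  have hElo : physLevel (winLo j + 1) = physLevel (j + 1) := idxLevel_winLo j
  have hEhi : physLevel (j + 1) < physLevel (winHi j + 1) := idxLevel_winHi j
  obtain ⟨hjl, hju, hjpos⟩ := hab j hjM
  have hfloor : 0 < linkC B ^ 3 * Real.exp (-(physLevel (j + 1) * bareLambda B) - C * bareLambda B ^ 2) :=
    mul_pos hν (Real.exp_pos _)
  obtain ⟨hw3a, hw3b, hw3c⟩ := hWIN j (winLo j) (winHi j) hjM hlo hhi hElo hEhi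
  refine ⟨hfloor, hjpos, fun m hm1 hm2 => ?_, fun n => ?_, hw3a, hGAP _ _ hlo hhi (by rw [hElo]; exact hEhi), hw3b, hw3c⟩
  · -- (w1)
    have hmM : m ≤ K + 1 := by omega
    have hEm : physLevel (m + 1) = physLevel (j + 1) := idxLevel_eq_of_mem_window hm1 hm2
    obtain ⟨hml, hmu, -⟩ := hab m hmM
    rw [hEm] at hml hmu
    exact ⟨hml, hmu, hSPREAD m j hmM hjM hEm⟩
  · -- (w2): `λ_0 ≤ ν e^{−E_0 x + Cx²} = e^{(E_j − E_0)x + 2Cx²} · floor_j` exactly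
    obtain ⟨-, h0u, -⟩ := hab 0 (Nat.zero_le _)
    have h00 : 0 ≤ levelValue su2Rep 1 B 0 := (hab 0 (Nat.zero_le _)).2.2.le
    have e1 : linkC B ^ 3 * Real.exp (-(physLevel (0 + 1) * bareLambda B) + C * bareLambda B ^ 2) =
        Real.exp ((physLevel (j + 1) - physLevel (0 + 1)) * bareLambda B + 2 * C * bareLambda B ^ 2) *
          (linkC B ^ 3 * Real.exp (-(physLevel (j + 1) * bareLambda B) - C * bareLambda B ^ 2)) := by
      rw [mul_left_comm, ← Real.exp_add]; congr 2; ring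
    have hstep := h0u.trans_eq e1
    calc levelValue su2Rep 1 B 0 ^ (2 * n)
        ≤ (Real.exp ((physLevel (j + 1) - physLevel (0 + 1)) * bareLambda B + 2 * C * bareLambda B ^ 2) *
            (linkC B ^ 3 * Real.exp (-(physLevel (j + 1) * bareLambda B) - C * bareLambda B ^ 2))) ^ (2 * n) :=
          pow_le_pow_left₀ h00 hstep _
      _ = Real.exp (2 * n * ((physLevel (j + 1) - physLevel (0 + 1)) * bareLambda B + 2 * C * bareLambda B ^ 2)) *
            (linkC B ^ 3 * Real.exp (-(physLevel (j + 1) * bareLambda B) - C * bareLambda B ^ 2)) ^ (2 * n) := by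
          rw [mul_pow, ← Real.exp_nat_mul]; push_cast; ring_nf

end Summit.QuantumFields.YangMills.Theorems.FemtoTransferGap.PScal

end
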